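import Summits.QuantumFields.YangMills.Theorems.BalabanUVNodesN11KernelTransportSkewProduct

/-!
# DAG node N11 — RE-COORDINATISATION OF def-T's KERNEL TRANSPORT ALONG MEASURABLE MAPS OF BOTH CARRIERS; the skew-product chain rule TRANSPORTED

HEADER — WORK-UNIT METADATA.  Cell `pub-ymgap`, YM-PLAN Track A (HUMAN RULING D-0062 ∕ D-0149), WIDTH SEAT `pub-ymgap-dag-n11-w2` (g3) on node
N11 [B14]; route `BalabanUVNodes`, key item K1⁷ `StabilityBAtRecordR13SepCoPH` = stmt-QuantumFields-20542 (helper, `--kind proof --supports 20542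
--as helper`, count-neutral).  [I] = [Balaban1987RG1], [III] = [Balaban1988Convergent].  Bus: CLAIM-2 = INTENT-2 of this seat (R455 (A)); sequel of
FILE 1 `…N11KernelTransportSkewProduct` (the skew-product chain rule for `T4AveragingDisintegration.kernelTransport` on PRODUCT carriers).

WHY.  def-T's transport of record `transportOfRecord k = kernelTransport (fieldMeasure k) (fieldMeasure (k+1)) avOfRecord` lives on ONE-CARRIER configuration
spaces `GaugeField (F.P K) k (SU N) = (PBond → SU N)`; FILE 1's separation face is stated on PRODUCT carriers `B × D` (outside × inside fine variables) and
`A × R` (outside × rest coarse variables).  To read the one through the other one presents each carrier by a measurable map from the product —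
at the record: the bond-partition glue (dag-n11-d's `measurePreserving_splitGlue`, Mathlib `MeasurableEquiv.piEquivPiSubtypeProd`) — and needs to
know that the kernel transport is NATURAL under such presentations.  THIS FILE is that naturality, generically: the fine carrier may be presented by ANY
measurable map `e_β : β' → β` pushing `ν'` to `ν` (a glue, a chart, a quotient — no injectivity asked), the coarse carrier by a measurable equivalence
`e_α : α' ≃ᵐ α` pushing `μ'` to `μ`, intertwining the averagings (`avg ∘ e_β = e_α ∘ avg'`).

WHAT THIS FILE PROVES (generic measurable spaces; `β`, `β'` standard Borel non-empty; `ν`, `ν'` finite; `μ`, `μ'` σ-finite; 0 `def`, 0 `sorry`).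
* §1 `absolutelyContinuous_of_recoord` (a.c. of the presented averaging from a.c. of the presenting one — any measurable `e_α`) ·
  `absolutelyContinuous_recoord` (conversely, along an equivalence `e_α`) · `integrable_comp_of_map_eq` · ★★ `kernelTransport_recoord_ae_eq`:
  `(kernelTransport ν μ avg ρ) ∘ e_α =ᵐ[μ'] kernelTransport ν' μ' avg' (ρ ∘ e_β)` (push-forward identity on both sides, `integral_map` ∕ `integral_map_equiv`,
  a.e. uniqueness on `μ'`) · `kernelTransport_recoord_fine_ae_eq` (the fine carrier alone re-presented, `e_α = id`).
* §2 ★★★ `kernelTransport_skewProduct_recoord_ae_eq` — FILE 1 §4 TRANSPORTED: for presentations `e_β : B × D → β` of `ν` by `ν_out ⊗ ν_in` and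
  `e_α : A × R ≃ᵐ α` of `μ` by `μ_out ⊗ μ_r` with the SKEW INTERTWINING `avg (e_β U) = e_α (avg_out U.1, avg_rest U)`, under FILE 1's hypotheses
  (`hac_out`, `hac_in`, displayed inner reading `hin` of the PRESENTED density `ρ ∘ e_β`):
  `(kernelTransport ν μ avg ρ) ∘ e_α =ᵐ[μ_out ⊗ μ_r] (V_out, r) ↦ kernelTransport ν_out μ_out avg_out (F (·, r)) V_out` — the one-carrier transport READ THROUGH
  the presentation IS the separated transport; `…_chartReading` twin with `F` the fibre integral of §3's assembled chart (FILE 1).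
* §3 (kernel-free) `map_comp_eq_restrict_of_map_eq_restrict_preimage` (+ `_congr_preimage`): a fibre-chart SOCKET `hpush` on the presenting fine
  carrier (chart `Ψ'` into `β'`, charted set `e ⁻¹' S`) is a socket on the presented one for the composed chart `e ∘ Ψ'` — so a chart seat may
  build its chart in coordinates (e.g. Lie-algebra-valued bond fields under the bondwise exponential chart) and hand dag-n11-d's socket the composite.

NOT IN THIS FILE: the presentations at the record (`splitGlue` ∕ `piEquivPiSubtypeProd` instances on `GaugeField` — dag-n11-d's lane), `avOfRecord`'s skew
shape over a bond partition (dag-n11-e's `Node00/AveragingTwoBlockWindow`), the `vOp ∕ kernelRTOfRecord` identification (node00-def-T's swap face ∕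
dag-n11-d's conditional «11a bridge»), any chart or Jacobian.

HONEST FRAMING.  Helper lane of K1⁷, count-neutral; [folklore] measure theory (`integral_map`, the push-forward identity `integral_kernelTransport_mul`,
a.e. uniqueness `ae_eq_of_forall_integral_mul_eq`) over def-T's DEFINITIONS; nothing of Bałaban's asserted; (B4) ∕ (S-α) NOT closed; no registered stub
proved; N11 NOT discharged; K1⁷ NOT closed; counts unmoved (typed 28∕28 · discharged 5∕27).  One finite four-torus programme at fixed `ε = L^{−K}`; R4
closes only the conditional finite-𝕋⁴ rung `BalabanLadder.UV` — NOT ℝ⁴, NOT OS, NOT a mass gap, NOT Clay.  No `sorry`, `axiom`, `def`, `instance`,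
`notation`.  Sources (SHAPE only): [III] (2.20)–(2.21) p.258, (3.1) p.264; [I] (0.13) p.254.
-/

noncomputable section

open MeasureTheory ProbabilityTheory Set Filter
open scoped ENNReal NNReal

namespace Summit.QuantumFields.YangMills.Theorems.BalabanUVNodesN11KernelTransportRecoordinatisation

open Literature.MathematicalPhysics.QuantumFieldTheory.Balaban1983to89
open T4AveragingDisintegration (kernelTransport integral_kernelTransport_mul integrable_kernelTransport ae_eq_of_forall_integral_mul_eq)
open BalabanUVNodesN11KernelTransportSkewProduct (kernelTransport_skewProduct_ae_eq measurable_integral_skewChartReading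
  absolutelyContinuous_map_comp_of_map_map map_prodMap_id_absolutelyContinuous)

/-! ## §1  Naturality of the kernel transport under presentations of the carriers -/

section Recoord

variable {α α' β β' : Type*} [MeasurableSpace α] [MeasurableSpace α'] [MeasurableSpace β] [MeasurableSpace β']

/-- The push-forwards along intertwined averagings: `(ν'.map e_β).map avg = (ν'.map avg').map e_α` when `avg ∘ e_β = e_α ∘ avg'`. -/
theorem map_map_avg_eq_of_intertwine (ν' : Measure β') {e_β : β' → β} (he_β : Measurable e_β) {e_α : α' → α} (he_α : Measurable e_α)
    {avg : β → α} {avg' : β' → α'} (havg : Measurable avg) (havg' : Measurable avg') (hint : ∀ U', avg (e_β U') = e_α (avg' U')) :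
    (ν'.map e_β).map avg = (ν'.map avg').map e_α := by
  rw [Measure.map_map havg he_β, Measure.map_map he_α havg']
  congr 1
  funext U'
  exact hint U'

/-- **a.c. OF THE PRESENTED STEP from a.c. of the presenting one** (any measurable `e_α`): if `ν'.map avg' ≪ μ'`, then
`(ν'.map e_β).map avg ≪ μ'.map e_α`. -/
theorem absolutelyContinuous_of_recoord (ν' : Measure β') (μ' : Measure α') {e_β : β' → β} (he_β : Measurable e_β)
    {e_α : α' → α} (he_α : Measurable e_α) {avg : β → α} {avg' : β' → α'} (havg : Measurable avg) (havg' : Measurable avg')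
    (hint : ∀ U', avg (e_β U') = e_α (avg' U')) (hac' : ν'.map avg' ≪ μ') :
    (ν'.map e_β).map avg ≪ μ'.map e_α := by
  rw [map_map_avg_eq_of_intertwine ν' he_β he_α havg havg' hint]
  exact hac'.map he_α

/-- **a.c. OF THE PRESENTING STEP from a.c. of the presented one**, along a measurable EQUIVALENCE of the coarse carriers: if
`(ν'.map e_β).map avg ≪ μ'.map e_α`, then `ν'.map avg' ≪ μ'`. -/
theorem absolutelyContinuous_recoord (ν' : Measure β') (μ' : Measure α') {e_β : β' → β} (he_β : Measurable e_β) (e_α : α' ≃ᵐ α)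
    {avg : β → α} {avg' : β' → α'} (havg : Measurable avg) (havg' : Measurable avg') (hint : ∀ U', avg (e_β U') = e_α (avg' U'))
    (hac : (ν'.map e_β).map avg ≪ μ'.map e_α) : ν'.map avg' ≪ μ' := by
  rw [map_map_avg_eq_of_intertwine ν' he_β e_α.measurable havg havg' hint] at hac
  have h := hac.map e_α.symm.measurable
  rwa [Measure.map_map e_α.symm.measurable e_α.measurable, Measure.map_map e_α.symm.measurable e_α.measurable,
    e_α.symm_comp_self, Measure.map_id, Measure.map_id] at h

/-- An integrable function of the presented fine carrier pulls back to an integrable function of the presenting one. -/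
theorem integrable_comp_of_map_eq (ν' : Measure β') {ν : Measure β} {e_β : β' → β} (he_β : Measurable e_β) (hν : ν'.map e_β = ν)
    {ρ : β → ℝ} (hρ : Integrable ρ ν) : Integrable (ρ ∘ e_β) ν' := by
  rw [← hν] at hρ
  exact (integrable_map_measure hρ.aestronglyMeasurable he_β.aemeasurable).1 hρ

variable [StandardBorelSpace β] [Nonempty β] [StandardBorelSpace β'] [Nonempty β']

/-- ★★ **NATURALITY OF THE KERNEL TRANSPORT UNDER PRESENTATIONS OF BOTH CARRIERS.**  Fine carrier presented by a measurable `e_β : β' → β` with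
`ν'.map e_β = ν` (no injectivity asked), coarse carrier by a measurable equivalence `e_α : α' ≃ᵐ α` with `μ'.map e_α = μ`, averagings intertwined
(`avg ∘ e_β = e_α ∘ avg'`), `ν.map avg ≪ μ`, `ρ` integrable.  THEN the transport of `ρ` along `avg`, read in the `α'`-coordinates, IS the transport of
the pulled-back density along the presenting averaging: `(kernelTransport ν μ avg ρ) ∘ e_α =ᵐ[μ'] kernelTransport ν' μ' avg' (ρ ∘ e_β)` (both are
`μ'`-integrable and have the same integral against every bounded measurable test: `integral_map_equiv` on the left, `integral_map` on the right, the
push-forward identity on both; a.e. uniqueness). -/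
theorem kernelTransport_recoord_ae_eq (ν : Measure β) [IsFiniteMeasure ν] (ν' : Measure β') [IsFiniteMeasure ν']
    (μ : Measure α) [SigmaFinite μ] (μ' : Measure α') [SigmaFinite μ']
    {e_β : β' → β} (he_β : Measurable e_β) (hν : ν'.map e_β = ν) (e_α : α' ≃ᵐ α) (hμ : μ'.map e_α = μ)
    {avg : β → α} {avg' : β' → α'} (havg : Measurable avg) (havg' : Measurable avg')
    (hint : ∀ U', avg (e_β U') = e_α (avg' U')) (hac : ν.map avg ≪ μ) {ρ : β → ℝ} (hρ : Integrable ρ ν) :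
    (kernelTransport ν μ avg ρ) ∘ e_α =ᵐ[μ'] kernelTransport ν' μ' avg' (ρ ∘ e_β) := by
  subst hν hμ
  have hac' : ν'.map avg' ≪ μ' := absolutelyContinuous_recoord ν' μ' he_β e_α havg havg' hint hac
  have hρ' : Integrable (ρ ∘ e_β) ν' := integrable_comp_of_map_eq ν' he_β rfl hρ
  have hT : Integrable (kernelTransport (ν'.map e_β) (μ'.map e_α) avg ρ) (μ'.map e_α) :=
    integrable_kernelTransport _ _ havg hac hρ
  have hT' : Integrable ((kernelTransport (ν'.map e_β) (μ'.map e_α) avg ρ) ∘ e_α) μ' :=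
    (integrable_map_measure hT.aestronglyMeasurable e_α.measurable.aemeasurable).1 hT
  refine ae_eq_of_forall_integral_mul_eq hT' (integrable_kernelTransport ν' μ' havg' hac' hρ') fun f hf hC => ?_
  obtain ⟨C, hC⟩ := hC
  -- the test read on `α` through the inverse equivalence
  have hfs : Measurable (f ∘ e_α.symm) := hf.comp e_α.symm.measurable
  have hCs : ∀ V, |(f ∘ e_α.symm) V| ≤ C := fun V => hC _
  have hgm : AEStronglyMeasurable (fun U => ρ U * (f ∘ e_α.symm) (avg U)) (ν'.map e_β) :=
    hρ.aestronglyMeasurable.mul (hfs.comp havg).aestronglyMeasurable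
  calc ∫ x, ((kernelTransport (ν'.map e_β) (μ'.map e_α) avg ρ) ∘ e_α) x * f x ∂μ'
      = ∫ x, (fun V => kernelTransport (ν'.map e_β) (μ'.map e_α) avg ρ V * (f ∘ e_α.symm) V) (e_α x) ∂μ' := by
        refine integral_congr_ae (ae_of_all _ fun x => ?_)
        simp only [Function.comp_apply, e_α.symm_apply_apply]
    _ = ∫ V, kernelTransport (ν'.map e_β) (μ'.map e_α) avg ρ V * (f ∘ e_α.symm) V ∂(μ'.map e_α) :=
        (integral_map_equiv (μ := μ') e_α
          (fun V => kernelTransport (ν'.map e_β) (μ'.map e_α) avg ρ V * (f ∘ e_α.symm) V)).symm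
    _ = ∫ U, ρ U * (f ∘ e_α.symm) (avg U) ∂(ν'.map e_β) :=
        integral_kernelTransport_mul _ _ havg hac hρ hfs hCs
    _ = ∫ U', ρ (e_β U') * (f ∘ e_α.symm) (avg (e_β U')) ∂ν' := integral_map he_β.aemeasurable hgm
    _ = ∫ U', (ρ ∘ e_β) U' * f (avg' U') ∂ν' := by
        refine integral_congr_ae (ae_of_all _ fun U' => ?_)
        simp only [Function.comp_apply, hint U', e_α.symm_apply_apply]
    _ = ∫ x, kernelTransport ν' μ' avg' (ρ ∘ e_β) x * f x ∂μ' := (integral_kernelTransport_mul ν' μ' havg' hac' hρ' hf hC).symm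

/-- The fine carrier ALONE re-presented (`e_α = id`): `kernelTransport (ν'.map e_β) μ avg ρ =ᵐ[μ] kernelTransport ν' μ (avg ∘ e_β) (ρ ∘ e_β)` —
e.g. the one-step transport read through a gauge-fixing section, a product chart of the fine configuration space, or a glue of bond groups. -/
theorem kernelTransport_recoord_fine_ae_eq (ν' : Measure β') [IsFiniteMeasure ν'] (μ : Measure α) [SigmaFinite μ]
    {e_β : β' → β} (he_β : Measurable e_β) {avg : β → α} (havg : Measurable avg) (hac : (ν'.map e_β).map avg ≪ μ)
    {ρ : β → ℝ} (hρ : Integrable ρ (ν'.map e_β)) :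
    haveI : IsFiniteMeasure (ν'.map e_β) := Measure.isFiniteMeasure_map ν' e_β
    kernelTransport (ν'.map e_β) μ avg ρ =ᵐ[μ] kernelTransport ν' μ (avg ∘ e_β) (ρ ∘ e_β) := by
  haveI : IsFiniteMeasure (ν'.map e_β) := Measure.isFiniteMeasure_map ν' e_β
  exact kernelTransport_recoord_ae_eq (ν'.map e_β) ν' μ μ he_β rfl (MeasurableEquiv.refl α) Measure.map_id
    havg (havg.comp he_β) (fun _ => rfl) hac hρ

end Recoord

/-! ## §2  The skew-product chain rule transported to a one-carrier transport presented by products -/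

section SkewRecoord

variable {α β A B D R X : Type*} [MeasurableSpace α] [MeasurableSpace β] [MeasurableSpace A] [MeasurableSpace B] [MeasurableSpace D]
  [MeasurableSpace R] [MeasurableSpace X]
  [StandardBorelSpace β] [Nonempty β] [StandardBorelSpace B] [Nonempty B] [StandardBorelSpace D] [Nonempty D]
  [StandardBorelSpace R] [Nonempty R]

/-- ★★★ **THE ONE-CARRIER TRANSPORT READ THROUGH A PRODUCT PRESENTATION IS THE SEPARATED TRANSPORT.**  A one-carrier step (`ν` on `β`, `μ` on `α`,
`avg : β → α`, `ν.map avg ≪ μ`) presented by `e_β : B × D → β` (`(ν_out ⊗ ν_in).map e_β = ν`; any measurable map) and `e_α : A × R ≃ᵐ α`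
(`(μ_out ⊗ μ_r).map e_α = μ`) with the SKEW INTERTWINING `avg (e_β U) = e_α (avg_out U.1, avg_rest U)` — the outside coarse variables read the outside fine
variables only —, FILE 1's side conditions `hac_out`, `hac_in`, and the displayed inner reading `hin` of the presented density `ρ ∘ e_β`.  THEN, in the
product coordinates of the coarse carrier, `(kernelTransport ν μ avg ρ) ∘ e_α =ᵐ[μ_out ⊗ μ_r] (V_out, r) ↦ kernelTransport ν_out μ_out avg_out (F (·, r)) V_out`
(§1 naturality ∘ FILE 1 §4). -/
theorem kernelTransport_skewProduct_recoord_ae_eq (ν : Measure β) [IsFiniteMeasure ν] (μ : Measure α) [SigmaFinite μ]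
    (ν_out : Measure B) [IsFiniteMeasure ν_out] (ν_in : Measure D) [IsFiniteMeasure ν_in]
    (μ_out : Measure A) [SigmaFinite μ_out] (μ_r : Measure R) [IsFiniteMeasure μ_r]
    {e_β : B × D → β} (he_β : Measurable e_β) (hν : (ν_out.prod ν_in).map e_β = ν)
    (e_α : A × R ≃ᵐ α) (hμ : (μ_out.prod μ_r).map e_α = μ)
    {avg : β → α} (havg : Measurable avg) {avg_out : B → A} (havg_out : Measurable avg_out)
    {avg_rest : B × D → R} (havg_rest : Measurable avg_rest)
    (hint : ∀ U, avg (e_β U) = e_α (avg_out U.1, avg_rest U)) (hac : ν.map avg ≪ μ)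
    (hac_out : ν_out.map avg_out ≪ μ_out)
    (hac_in : (ν_out.prod ν_in).map (fun U => (U.1, avg_rest U)) ≪ ν_out.prod μ_r)
    {ρ : β → ℝ} (hρ : Integrable ρ ν) {F : B × R → ℝ} (hFm : Measurable F)
    (hin : kernelTransport (ν_out.prod ν_in) (ν_out.prod μ_r) (fun U => (U.1, avg_rest U)) (ρ ∘ e_β) =ᵐ[ν_out.prod μ_r] F) :
    (kernelTransport ν μ avg ρ) ∘ e_α
      =ᵐ[μ_out.prod μ_r] fun p => kernelTransport ν_out μ_out avg_out (fun u => F (u, p.2)) p.1 := by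
  have havg' : Measurable (fun U : B × D => (avg_out U.1, avg_rest U)) := (havg_out.comp measurable_fst).prodMk havg_rest
  have hρ' : Integrable (ρ ∘ e_β) (ν_out.prod ν_in) := integrable_comp_of_map_eq _ he_β hν hρ
  calc (kernelTransport ν μ avg ρ) ∘ e_α
      =ᵐ[μ_out.prod μ_r] kernelTransport (ν_out.prod ν_in) (μ_out.prod μ_r) (fun U => (avg_out U.1, avg_rest U)) (ρ ∘ e_β) :=
        kernelTransport_recoord_ae_eq ν (ν_out.prod ν_in) μ (μ_out.prod μ_r) he_β hν e_α hμ havg havg' hint hac hρ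
    _ =ᵐ[μ_out.prod μ_r] fun p => kernelTransport ν_out μ_out avg_out (fun u => F (u, p.2)) p.1 :=
        kernelTransport_skewProduct_ae_eq ν_out ν_in μ_out μ_r havg_out havg_rest hac_out hac_in hρ' hFm hin

/-- ★★★ The same IN THE CHART READING of FILE 1 §3's assembled inside chart: with `hin` supplied at the fibre integral
`(U_out, r) ↦ ∫ J (U_out,(r,x)) · (ρ ∘ e_β) (U_out, Ψ_in (U_out,(r,x))) dτ(x)` (dag-n11-d's socket theorem at the assembled chart),
`(kernelTransport ν μ avg ρ) ∘ e_α =ᵐ[μ_out ⊗ μ_r] (V_out, r) ↦ kernelTransport ν_out μ_out avg_out [U_out ↦ ∫ J · (ρ ∘ e_β)(U_out, Ψ_in (U_out,(r,·))) dτ] V_out`. -/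
theorem kernelTransport_skewProduct_recoord_ae_eq_chartReading (ν : Measure β) [IsFiniteMeasure ν] (μ : Measure α) [SigmaFinite μ]
    (ν_out : Measure B) [IsFiniteMeasure ν_out] (ν_in : Measure D) [IsFiniteMeasure ν_in]
    (μ_out : Measure A) [SigmaFinite μ_out] (μ_r : Measure R) [IsFiniteMeasure μ_r] (τ : Measure X) [SFinite τ]
    {e_β : B × D → β} (he_β : Measurable e_β) (hν : (ν_out.prod ν_in).map e_β = ν)
    (e_α : A × R ≃ᵐ α) (hμ : (μ_out.prod μ_r).map e_α = μ)
    {avg : β → α} (havg : Measurable avg) {avg_out : B → A} (havg_out : Measurable avg_out)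
    {avg_rest : B × D → R} (havg_rest : Measurable avg_rest)
    (hint : ∀ U, avg (e_β U) = e_α (avg_out U.1, avg_rest U)) (hac : ν.map avg ≪ μ)
    (hac_out : ν_out.map avg_out ≪ μ_out)
    (hac_in : (ν_out.prod ν_in).map (fun U => (U.1, avg_rest U)) ≪ ν_out.prod μ_r)
    {Ψ_in : B × (R × X) → D} (hΨ : Measurable Ψ_in) {J : B × (R × X) → ℝ≥0∞} (hJ : Measurable J)
    {ρ : β → ℝ} (hρm : Measurable ρ) (hρ : Integrable ρ ν)
    (hin : kernelTransport (ν_out.prod ν_in) (ν_out.prod μ_r) (fun U => (U.1, avg_rest U)) (ρ ∘ e_β)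
      =ᵐ[ν_out.prod μ_r] fun q => ∫ x, (J (q.1, (q.2, x))).toReal * (ρ ∘ e_β) (q.1, Ψ_in (q.1, (q.2, x))) ∂τ) :
    (kernelTransport ν μ avg ρ) ∘ e_α
      =ᵐ[μ_out.prod μ_r] fun p => kernelTransport ν_out μ_out avg_out
        (fun u => ∫ x, (J (u, (p.2, x))).toReal * (ρ ∘ e_β) (u, Ψ_in (u, (p.2, x))) ∂τ) p.1 :=
  kernelTransport_skewProduct_recoord_ae_eq ν μ ν_out ν_in μ_out μ_r he_β hν e_α hμ havg havg_out havg_rest hint hac hac_out hac_in hρ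
    (measurable_integral_skewChartReading τ hΨ hJ (hρm.comp he_β)) hin

end SkewRecoord

/-! ## §3  Sockets compose with a presentation of the fine carrier (kernel-free) -/

section SocketRecoord

variable {Z β β' : Type*} [MeasurableSpace Z] [MeasurableSpace β] [MeasurableSpace β']

/-- **A FIBRE-CHART SOCKET ON THE PRESENTING CARRIER IS A SOCKET ON THE PRESENTED ONE.**  If `e : β' → β` presents `ν` by `ν'`
(`ν'.map e = ν`; e.g. the bondwise exponential chart presenting product Haar by the Haar-density-weighted Lebesgue measure on the
Lie-algebra-valued bond fields, `HaarDensitySpecialUnitaryGlobalPi.measurePreserving_pi_expChart_specialUnitaryGroup`) and a chart `Ψ'`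
into `β'` pushes a reference `M` (e.g. `(μ ⊗ₘ κ).withDensity J`) onto `ν'` restricted to the pulled-back charted set, then the composed
chart `e ∘ Ψ'` pushes `M` onto `ν` restricted to the charted set: `M.map (e ∘ Ψ') = ν.restrict S` — dag-n11-d's `hpush` for `Ψ := e ∘ Ψ'`
(its `hfib` for `avg` is literally `hfib` for `avg ∘ e` on the presenting side, and a density vanishing off `S` pulls back to one vanishing
off `e ⁻¹' S`; Mathlib `Measure.map_map`, `Measure.restrict_map`). -/
theorem map_comp_eq_restrict_of_map_eq_restrict_preimage (M : Measure Z) {Ψ' : Z → β'} (hΨ' : Measurable Ψ')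
    {e : β' → β} (he : Measurable e) {ν' : Measure β'} {ν : Measure β} (hν : ν'.map e = ν) {S : Set β} (hS : MeasurableSet S)
    (hpush' : M.map Ψ' = ν'.restrict (e ⁻¹' S)) : M.map (e ∘ Ψ') = ν.restrict S := by
  rw [← Measure.map_map he hΨ', hpush', ← hν]
  exact (Measure.restrict_map he hS).symm

/-- The presented charted set may be replaced by any measurable `S'` with the same pull-back (`e ⁻¹' S' = e ⁻¹' S`, e.g. the
`e`-saturation of `S`): `M.map (e ∘ Ψ') = ν.restrict S'`. -/
theorem map_comp_eq_restrict_congr_preimage (M : Measure Z) {Ψ' : Z → β'} (hΨ' : Measurable Ψ')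
    {e : β' → β} (he : Measurable e) {ν' : Measure β'} {ν : Measure β} (hν : ν'.map e = ν) {S S' : Set β}
    (hS' : MeasurableSet S') (hSS' : e ⁻¹' S' = e ⁻¹' S)
    (hpush' : M.map Ψ' = ν'.restrict (e ⁻¹' S)) : M.map (e ∘ Ψ') = ν.restrict S' :=
  map_comp_eq_restrict_of_map_eq_restrict_preimage M hΨ' he hν hS' (by rw [hSS']; exact hpush')

end SocketRecoord


end Summit.QuantumFields.YangMills.Theorems.BalabanUVNodesN11KernelTransportRecoordinatisation
end
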